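import Summits.BirchSwinnertonDyer.Rank1Residual.F1Sign2.HalfPeriodWeilPairingAtTwo
import HarnessLib.Audit.Tags
import HarnessLib

/-!
# Cell `bsd-f1-sign2` — IMC lens (-imc g17; MEMO-imc §10.96-add1, -add2; D-imc-53 scope +1, +2): IMC-WP53 file 2 of 3 —
# P53m «AT MOST THREE 2-TORSION PLANES», P53f «FLAT SHARING LAW inside the Kilford stratum», and the REPAIRED parity / orientation laws P53i′ / P53o′ (supports)

STATEMENTS ONLY, typer -ty g16.  Source: `HOME/MEMO-imc-data/dimc53/lean/Sketch53.v4.lean` **d9205c894b9424ec**, blocks l.326–373 (`LiesInTwoTorsionPlaneAtTwo`, P53m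
`AtMostThreeTwoTorsionPlanesAtTwo`) and l.377–418 (`IsConnectedTwoTorsionRootAtTwo`, `MapsConnectedTwoTorsionRootAtTwo`, P53f `FlatSharingLawAtTwo`) VERBATIM (decl bodies
byte-identical, builder-verified); continues `F1Sign2/HalfPeriodWeilPairingAtTwo.lean` (imported).  **NOT FILED: the v4 bodies of P53i `ImaginaryOddTamagawaParityLawAtTwo`
(v4 l.429–434) and P53o `RealOddTamagawaOrientationLawAtTwo` (v4 l.445–452) — KILLED AS TYPED by REF1 §181** (both omit `Irreducible W'.twoTorsionPolynomial.toPoly`, so the junk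
CONSTANT carrier `g = C c`, `c` a rational 2-torsion abscissa of `W'`, satisfies `CarriesTwoTorsion W W' (C c)` for every `W` — kernel certificate `carriesTwoTorsion_const_of_root`,
Kernel file; T181i/T181o in `REF1-data/b181/lean/Probe181c.lean` — and the laws degenerate to blanket claims: Cremona `N < 4·10⁴` **P53i 10/19 frame pairs violate** (smallest
`5795b1 = [0,1,1,−5,4]`, `w = −1`, vs `5795e3`, `w = +1`, `ψ_{W'}(−405/4) = 0`), **P53o 25/45** (`141e1` vs `141c4`: both `w = +1` while the typed right side reads `63/4 < 63/4`) —
refuted-MISSTATED).  FILED INSTEAD under the SAME names (nothing of those names ever landed, so no primed name is needed): the REPAIRED rows P53i′/P53o′ = -imc g17's own fold of the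
repair in `Sketch53.lean` v6 **8e68f24aa3ca2168** (583 l., 12 Props rc 0, BC7 `Probe53v6` 12/12 CLEAN) l.421–439 / l.441–461: bodies VERBATIM (= the v4 bodies with REF1's minimal repair
C′ = the clause `Irreducible W'.twoTorsionPolynomial.toPoly →` inserted after `Irreducible W.twoTorsionPolynomial.toPoly →`, exactly as P53b/P53c/P53f carry it; builder-verified both
ways), docstrings = v6 text verbatim (its free-form bracket tag moved into parentheses) + one REF1 + one REF2 sentence, and filed as plain `def` SUPPORTS, not `@[conjecture]` rows
(REF1 §181: «type P53i′/P53o′ as supports, not conjectures» — THEOREM-grade per R181i/R181o; REF2 v48 §3: COROLLARY-OF-PRINT / PRINT-ASSEMBLY; cell convention supports → plain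
`def`).  NOT FILED from v5/v6: P53s `TwoSelmerRankTransferLawAtTwo`, P53s₀ `TwoSelmerCompanionLawAtTwo`, `le_of_isLeast_of_mem` (MEMO-imc §10.96-add3; REF1 D-imc-53-R4 audit
pending — REF-gated) and v6's extra `import …F1Sign2.DescentSignAtTwo` (only P53s needs it).
REF1-AUDIT §181 verdict lines for this file: «P53m: SURVIVES conjecture-grade = the Γ₀(N)-analogue of Kilford–Wiese Q1.9 (`#planes ≤ 3 = 2^r − 1`, r = 2): free when two
of the four forms coincide (cert `atMostThree_conclusion_of_eq`), and a COROLLARY of [BLR 1991: `J₀(N)[𝔪] ≅ ρ̄ ⊗ 𝔽₂^r` for absolutely irreducible ρ̄] + [r ≤ 2];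
P53m's `¬IsSquare` IS load-bearing.  P53f: SURVIVES (conjecture-grade; new bit isolated, rider R181f: P53f = [BLR] + [dim J₀(N)[𝔪]⁰ = 2r − 1] + [no Galois plane
inside J[2]⁰] — the 24 two-plane class-bits are its whole new content; `dim J₀(N)[𝔪]⁰ = 3` is FORCED at all ten 3-plane levels; the Weil pairing cannot decide the
rest: all modular degrees even, ARS).  P53i′/P53o′ THEOREM-grade (R181i: literal place-by-place Selmer isomorphism + Monsky 2-parity, no Poonen–Rains refinement
needed; R181o: never-middle R180a DERIVES the `[β=(12)]` correction: `w = w′ ⟺ β(e₁) < β(e₃)`).»  REF2-PLACEMENT v47 §27 (299463c69f0ab652): P53m = **OPEN IN PRINT as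
a question** ([cite: KilfordWiese2008, Question 1.9, Thm. 1.3, Thm. 1.8], prime level / Γ₁) and NOT IN PRINT as a statement for Γ₀(N) composite; the 31 new
composite-level failures of multiplicity one on `J₀(N)` (2071, 3159, 3807, 4825, 7725, 8973, 9153, …) extending [cite: Kilford2002, main theorem]'s {431, 503, 2089}
are a printable-grade computational fact; [cite: Wiese2007Multiplicities, Thm. 1.1].  REF2-PLACEMENT v48 §3 (a3854332596164e6, 07:47Z): P53i′ COROLLARY OF PRINT ([cite: Cesnavicius2016SelmerFlat, Thm. 1.1(a)(b)] + [cite: PoonenRains2012, Prop. 4.12] + (E1) +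
[cite: Monsky1996, Thm. 1.5]), P53o′ PRINT-ASSEMBLY ≈ 12 lines ([cite: PoonenRains2012, Prop. 4.10, Thm. 4.13(a)]), P53f NOT IN PRINT (locus = [cite: KilfordWiese2008, Thm. 1.2(c), Thm. 1.3]);
REF2 v48 §7: concordance with REF1 §181 — AGREE on P53i′/P53o′.  Further keys used below: [cite: BostonLenstraRibet1991, Thm. 1], [cite: Conrad1999, §1].  BSD not proved; PARTITION none; no item closed.
-/

set_option autoImplicit false

noncomputable section

open scoped Classical MatrixGroups ModularForm

open CongruenceSubgroup WeierstrassCurve Literature.NumberTheory.EllipticCurves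
  Literature.NumberTheory.EllipticCurves.ModularForms Literature.NumberTheory.EllipticCurves.Sprung2017

namespace Summit.BirchSwinnertonDyer.Rank1Residual.F1Sign2


/-! ### P53m — «AT MOST THREE PLANES»: multiplicity at most two, read at symbol level
(a by-product law of the census; it lives ON the Kilford stratum, where 53b/53c are silent) -/

/-- The symbol-level relation «both mod-`2` loop functionals of `f'` lie in the span of those of `f`»
— the conclusion of `SharedTwoTorsionPlaneAtTwo` as a binary relation on weight-`2` cusp forms of
level `N` (for optimal congruent curves: `ι_{E'} E'[2] = ι_E E[2]` inside `J₀(N)[2]`). [folklore]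
REF1-AUDIT §181: REFLEXIVE (`liesInTwoTorsionPlane_refl`, Kernel file), so P53m's conclusion is free as soon as two of the four newforms coincide
(`atMostThree_conclusion_of_eq`); sharing is transitive in the census (M2: 0 non-transitive classes). -/
def LiesInTwoTorsionPlaneAtTwo {N : ℕ} (f f' : CuspForm (Gamma0 N) 2) : Prop :=
  ((∀ r : ℚ, Nat.Coprime r.den N → ModTwoCongr (twicePlusLoopSymbol f' r) (twicePlusLoopSymbol f r)) ∨
      (∀ r : ℚ, Nat.Coprime r.den N → ModTwoCongr (twicePlusLoopSymbol f' r) (twiceMinusLoopSymbol f r)) ∨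
      (∀ r : ℚ, Nat.Coprime r.den N → ModTwoCongr (twicePlusLoopSymbol f' r)
        (twicePlusLoopSymbol f r + twiceMinusLoopSymbol f r))) ∧
    ((∀ r : ℚ, Nat.Coprime r.den N → ModTwoCongr (twiceMinusLoopSymbol f' r) (twicePlusLoopSymbol f r)) ∨
      (∀ r : ℚ, Nat.Coprime r.den N → ModTwoCongr (twiceMinusLoopSymbol f' r) (twiceMinusLoopSymbol f r)) ∨
      (∀ r : ℚ, Nat.Coprime r.den N → ModTwoCongr (twiceMinusLoopSymbol f' r)
        (twicePlusLoopSymbol f r + twiceMinusLoopSymbol f r)))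

/-- **CANDIDATE IMC-53m `AtMostThreeTwoTorsionPlanesAtTwo` (D-imc-53 by-product; OPEN,
conjecture-grade).**  «MULTIPLICITY AT MOST TWO, IN MODULAR-SYMBOL CURRENCY»: among any FOUR elliptic
curves of the same odd conductor `N` that are congruent mod `2` (isomorphic cubic `2`-division fields,
`S₃` image) two have mod-`2` loop symbols spanning the same plane (`LiesInTwoTorsionPlaneAtTwo`);
equivalently the planes `ι_E E[2] ⊂ J₀(N)[𝔪]` of the optimal curves in one mod-`2` congruence class
take AT MOST THREE values.  REASON TO BELIEVE: if `J₀(N)[𝔪] ≅ ρ̄ ⊕ ρ̄` (multiplicity exactly two, `ρ̄`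
absolutely irreducible) its `ρ̄`-subplanes are the `|ℙ¹(𝔽₂)| = 3` points of `ℙ(Hom_G(ρ̄, ρ̄ ⊕ ρ̄))`;
a non-split `J[𝔪]` of length two has ONE; multiplicity one gives one (53c).  So 53m ⟸ «`dim_{𝔽₂}
J₀(N)[𝔪] ≤ 4` for `𝔪 = (2, T_ℓ − a_ℓ(E))`, `E[2]` irreducible, `N` odd» — Kilford–Wiese's QUESTION 1.9
(«is the multiplicity always equal to 2?», asked at PRIME level on `J₁(N)` for dihedral/Katz forms;
their 384 examples all have Gorenstein defect `2 = 2r − 2`) transplanted to `Γ₀(N)`, composite odd `N`,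
`ρ̄ = E[2]`, and made checkable by modular symbols alone.
WITNESS (kit j326601, odd `N < 10⁴`): the 43 Kilford-stratum congruence classes have plane counts
`{1: 9, 2: 24, 3: 10}` — never more than three; the pigeonhole is non-vacuous in the 12 classes with
≥ 4 optimal curves (2089: 4 curves → 3 planes; 3807 and 4825: SIX curves → exactly 3 planes; 7725: 6 → 2;
8973: 5 → 2; 3159, 8183, 8289, 9153: 4 → 2; 7057: 4 → 3; 3969, 8281: 4 → 1) with 0 violations; sharing is
transitive (0 violations among 152 pairs), as «same plane» must be; every transversal pair certifies
`ρ̄ ⊕ ρ̄ ⊆ J₀(N)[𝔪]`, i.e. FAILURE of multiplicity one on `J₀(N)`, at 34 levels `< 10⁴` (431, 503, 2089 =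
Kilford 2002; the other 31 — 2071, 2631, 3159, 3431, 3639, 3807, 3879, 4415, 4481, 4527, 4799, 4825, 5095,
5275, 5919, 5997, 6199, 7057, 7223, 7359, 7725, 7893, 8071, 8183, 8289, 8623, 8973, 9127, 9153, 9455, 9687 —
by this census); all 1696 classes off the stratum have one plane (53c).  CHEAPEST FALSIFIER: one odd level
with four pairwise-transversal optimal congruent curves (pre-registered extension: Kilford classes of
size ≥ 4, `10⁴ ≤ N < 4·10⁴`).  WHY IT MIGHT FAIL: multiplicity `r ≥ 3` (`J[𝔪] ⊇ ρ̄³` allows 7 planes)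
is not excluded in print at composite level — Wiese 2007 / Kilford–Wiese Thm 1.3 give only `r > 1` in the
scalar case, and `r = 2` is their open Question 1.9.
[cite: KilfordWiese2008, Question 1.9 + Thm. 1.3 + Thm. 1.8 (prime level, J₁(N); r = 2 in all 384 examples)]
REF1-AUDIT §181: **SURVIVES conjecture-grade = the Γ₀(N)-analogue of Kilford–Wiese Q1.9** (`#planes ≤ 3 = 2^r − 1`, `r = 2`): free when two of the four forms
coincide (cert `atMostThree_conclusion_of_eq` + the pigeonhole `exists_ne_map_eq_of_four_to_three`), and a **COROLLARY of [cite: BostonLenstraRibet1991, Thm. 1]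
(`J₀(N)[𝔪] ≅ ρ̄ ⊗ 𝔽₂^r` for absolutely irreducible `ρ̄`) + [r ≤ 2]**, since the Galois planes in `ρ̄ ⊗ A` are the `ρ̄ ⊗ a`, `a ∈ A∖0` — `2^r − 1 = 3` of them;
absolute irreducibility = `S₃` = `¬ IsSquare Δ` **IS LOAD-BEARING** (a `C₃`-plane `ρ̄ ≅ χ ⊕ χ²` over `𝔽₄` has MORE stable planes: the 13 `C₃` pairs at 1849/3969/8281
show 3 bijections each, B4b); census M1: Kilford classes by #planes {1: 9, 2: 24, 3: 10}, off-Kilford {1: 1 696}; rank of the 4 functionals ∈ {r, 2r} always (M0).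
REF2-PLACEMENT v47 §27: **OPEN IN PRINT as a question** ([cite: KilfordWiese2008, Question 1.9, Thm. 1.3, Thm. 1.8]: prime level / Γ₁, «is the multiplicity always
equal to 2?», all 384 examples have Gorenstein defect 2) and **NOT IN PRINT as a statement for Γ₀(N) composite**; a KILL (four pairwise-transversal curves) would be a
NEGATIVE answer to the Γ₀-analogue of Q1.9 (multiplicity 3); the 31 new composite-level failures of multiplicity one on `J₀(N)` (2071, 3159, 3807, 4825, 7725, 8973,
9153, …) extending [cite: Kilford2002, main theorem]'s {431, 503, 2089} are themselves a printable-grade computational fact; [cite: Wiese2007Multiplicities, Thm. 1.1];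
beyond-print theorem: no. -/
@[conjecture] def AtMostThreeTwoTorsionPlanesAtTwo : Prop :=
  ∀ {N : ℕ} [NeZero N] (W : Fin 4 → WeierstrassCurve ℚ) (f : Fin 4 → CuspForm (Gamma0 N) 2),
    Odd N → (∀ i, (W i).IsElliptic) → (∀ i, IsNewformOf (W i) (f i)) →
    (∀ i, Irreducible (W i).twoTorsionPolynomial.toPoly) → ¬ IsSquare (W 0).Δ →
    (∀ i, ∃ g : Polynomial ℚ, CarriesTwoTorsion (W 0) (W i) g) →
      ∃ i j : Fin 4, i ≠ j ∧ LiesInTwoTorsionPlaneAtTwo (f i) (f j)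

/-! ### v4 (2026-08-29, §10.96-add2) — the sharing criterion inside the Kilford stratum, and two parity laws

Inside the Kilford stratum (`TwoTorsionSplitAtTwo W`: all of `E[2]` is `ℚ₂`-rational, `E` ordinary at `2`) the
Galois bijection `β : E'[2] → E[2]` need not respect the connected–étale filtration of the finite flat group
schemes `𝓔[2] ≅ μ₂ × ℤ/2` over `ℤ₂`.  The CONNECTED point is the `2`-torsion point in the formal group; on the
`2`-division cubic it is the root ISOLATED from the other two `2`-adically (in a `2`-integral model the connected
root of `X³ + b₂X² + 8b₄X + 16b₆` is the odd one, the two étale roots are even), a characterisation invariant under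
`x ↦ u²x + r`, hence model-independent.  Census `dimc53` N < 10⁴ (152 Kilford pairs, two engines: PARI plane test
`k53.gp` j326601 and the exact local 2-descent `d2_test.py`): shared symbol plane ⟺ `β` maps connected point to
connected point — 49/49 and 103/103, i.e. **152/152** (P53f below); P53m (`≤ 3` planes) is its corollary. -/

/-- `x ∈ ℚ₂` is the **connected** root of the `2`-division cubic `ψ_W` at `2`: a root isolated from the other
two (`‖y − z‖ < ‖x − y‖` for the other roots `y ≠ z`).  Model-independent (affine substitutions scale all
three distances by the same factor).  Meaningful when `TwoTorsionSplitAtTwo W`. [folklore]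
REF1-AUDIT §181: = «`x` is a `ℚ₂`-root and the other two roots are 2-adically closer to each other than to `x`» — on the Kilford stratum this is EXACTLY the
root of the point in the formal group (C1: in `X = 4x`-coordinates the cubic `X³ + b₂X² + 8b₄X + 16b₆` has one odd root (`v(x) = −2`, the kernel of reduction)
and two even roots, 152/152 Kilford curves), unique, so `MapsConnectedTwoTorsionRootAtTwo` is a genuine one-bit condition (`mapsConnected_refl`, Kernel file). -/
def IsConnectedTwoTorsionRootAtTwo (W : WeierstrassCurve ℚ) (x : ℚ_[2]) : Prop :=
  (W.twoTorsionPolynomial.toPoly.map (algebraMap ℚ ℚ_[2])).IsRoot x ∧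
    ∀ y z : ℚ_[2], (W.twoTorsionPolynomial.toPoly.map (algebraMap ℚ ℚ_[2])).IsRoot y →
      (W.twoTorsionPolynomial.toPoly.map (algebraMap ℚ ℚ_[2])).IsRoot z → y ≠ x → z ≠ x → y ≠ z →
        ‖y - z‖ < ‖x - y‖

/-- `g` (a carrier of the `2`-torsion, `CarriesTwoTorsion W W' g`) maps the connected root of `ψ_W` at `2`
to the connected root of `ψ_{W'}`: `β = β_g` extends to an isomorphism of finite flat group schemes
`𝓔[2] ≅ 𝓔'[2]` over `ℤ₂`. [folklore] -/
def MapsConnectedTwoTorsionRootAtTwo (W W' : WeierstrassCurve ℚ) (g : Polynomial ℚ) : Prop :=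
  ∀ x : ℚ_[2], IsConnectedTwoTorsionRootAtTwo W x →
    IsConnectedTwoTorsionRootAtTwo W' ((g.map (algebraMap ℚ ℚ_[2])).eval x)

/-- **P53f — FLAT SHARING LAW inside the Kilford stratum** (conjecture; census 152/152, two engines).
For optimal curves `E ~ f`, `E' ~ f'` of the same odd conductor `N` with isomorphic irreducible non-cyclic
`E[2]` lying in the Kilford stratum, the mod-2 modular-symbol planes coincide
(`LiesInTwoTorsionPlaneAtTwo f f'`, i.e. `ι_E E[2] = ι_{E'} E'[2]` in `J₀(N)[2]` read through S53) **iff**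
the Galois bijection respects the connected `2`-torsion points at `2`.  Off the stratum both sides hold
(P53c, 6253/6253).  Why it might fail: a level where `J₀(N)[𝔪]` has multiplicity `≥ 3`
(Kilford–Wiese only prove `2` under their hypotheses) could host a shared plane with a flat mismatch.
[conjecture: this memo §10.96-add2; arXiv:math/0612317 Thm 1.3, Q 1.9]
REF1-AUDIT §181: **SURVIVES (conjecture-grade; new bit isolated, rider R181f)** — engine C (`check181c.py`, β from REAL roots, connected root := the odd `ℤ₂`-root,
exact matching mod `2⁶⁰`): «same plane ⟺ β maps connected root to connected root» **139/139** (13 `C₃` pairs excluded by `¬IsSquare`; agreement with -imc's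
`kil/conn_res_N1e4.json` 139/139 — two engines); STRUCTURE: with `V = J₀(N)[𝔪] ≅ ρ̄ ⊗ A` ([cite: BostonLenstraRibet1991, Thm. 1]; `A = 𝔽₂²` at the 33 multi-plane
levels) and `V⁰` its connected part, «shared ⟹ MapsConnected» is theorem-grade (`π^*` and odd isogenies respect `𝓔[2]⁰`, 36/36); in a 3-PLANE class BLR linear
algebra makes the pattern ALL-OR-NOTHING and the data say «nothing» 10/10 ⟹ **`dim_{𝔽₂} J₀(N)[𝔪]⁰ = 3` at every 3-plane level (503, 2089, 3431, 3807, 4481, 4527,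
4799, 4825, 7057, 9455)** — A-53-8 answered without a modular computation; in a 2-PLANE class (24 levels) P53f is ONE bit per class = «no Galois plane of
`J₀(N)[𝔪]` is totally connected»; so P53f = [BLR] + [dim V⁰ = 2r − 1] + [no stable plane inside V⁰], the last clause being the new conjectural content (34
class-bits, all as predicted; -imc kit j327065 extends to 4·10⁴); a Weil-pairing attack is VOID (every optimal curve in a multi-plane Kilford class has EVEN modular
degree — Ribet/Agashe–Ribet–Stein — so all planes are isotropic); `¬IsSquare` LOAD-BEARING here (1849b/c, 3969, 8281: 13 `C₃` pairs with 3 bijections each).  REF2-PLACEMENT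
v48 §3 (a3854332596164e6): P53f NOT IN PRINT (locus = [cite: KilfordWiese2008, Thm. 1.2, Thm. 1.3]); v49 §5 (333e5dcafceb55cb, the OWED STRUCTURE slot served): `V = J₀(N)[𝔪] ≅ ρ̄ ⊗ A` IN PRINT
[cite: BostonLenstraRibet1991, Thm. 1]; `dim A > 1 ⟹ ρ̄` unramified at 2 (multiplicity one whenever `ρ̄` is ramified at 2, so for every supersingular-at-2 class — tree fact
`buzzard2000_multiplicityOne_gamma0`, [cite: KilfordWiese2008, Thm. 1.2, Thm. 1.3], [cite: Wiese2007Multiplicities, Thm. 1.1]) = why the planes live on the Kilford (ordinary) stratum;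
finite flat side: the ordinary `𝓔[2]` is NOT determined by the Galois module (the `(2,1)` ambiguity `ℤ/2 ↔ μ₂`, Tate CSS97 §4.4–4.5; MRC15 «e(𝔭/p) < p − 1»), the extra datum = the
connected line; «shared plane ⟹ β respects the connected root» ELEMENTARY (schematic closure in the Néron model of `J₀(N)`, good at 2); the converse = P53f's content, NOT IN PRINT;
beyond-print theorem: no. -/
@[conjecture] def FlatSharingLawAtTwo : Prop :=
  ∀ {N : ℕ} [NeZero N] (W W' : WeierstrassCurve ℚ) (f f' : CuspForm (Gamma0 N) 2),
    Odd N → W.IsElliptic → W'.IsElliptic → IsNewformOf W f → IsNewformOf W' f' →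
    Irreducible W.twoTorsionPolynomial.toPoly → Irreducible W'.twoTorsionPolynomial.toPoly →
    ¬ IsSquare W.Δ → TwoTorsionSplitAtTwo W →
    ∀ g : Polynomial ℚ, CarriesTwoTorsion W W' g →
      (LiesInTwoTorsionPlaneAtTwo f f' ↔ MapsConnectedTwoTorsionRootAtTwo W W' g)

/-! ### P53i′ / P53o′ — the REPAIRED odd-Tamagawa parity / orientation laws (supports; REF1 §181 C′, -imc v6 fold) -/

/-- **SUPPORT P53i′ `ImaginaryOddTamagawaParityLawAtTwo` — IMAGINARY ODD-TAMAGAWA PARITY LAW, REPAIRED (REF1 §181 C′).**  -imc g17's text (Sketch53 v6): «P53i — IMAGINARY ODD-TAMAGAWA PARITY LAW (theorem-candidate; census 709/709 pairs N < 10⁴, all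
reduction types at `2`; REF1 L178 is its `a₂ = 0` shadow to N < 5·10⁵).  Same odd conductor, isomorphic
irreducible `E[2]`, `Δ < 0`, all Tamagawa numbers odd for both curves, outside the Kilford stratum ⟹ equal
root numbers.  Route to a proof: Monsky's 2-parity theorem + the parity lemma for `2`-Selmer structures on the
common `E[2]`: the local conditions agree at every `ℓ ∣ N` (`c_ℓ` odd ⟹ Kummer image = unramified classes),
at `∞` (`Δ < 0 ⟹ H¹(ℝ, E[2]) = 0`) and at `2` (flat structure forced by Galois off the Kilford stratum).
Why it might fail: the Poonen–Rains quadratic refinement of the local condition at `2` is curve-dependent;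
inside the Kilford stratum the naive lemma is violated in 30/122 Tam-odd pairs, so the proof must show the
refinement is Galois-forced off the stratum.  v6 (P53i′): the v4/v5 typing omitted `Irreducible ψ_{W'}` and was
KILLED-misstated by the constant carrier `g = C c` (REF1-AUDIT §181 T181i: 5795b1 vs 5795e3, 10/19); with the clause
REF1 R181i grades it THEOREM-grade (literal Selmer isomorphism place by place + Monsky).»
(-imc's tag: conjecture: MEMO-imc §10.96-add2/add3; Monsky 1996 (2-parity); REF1-AUDIT §181 R181i.)
FILED AS A SUPPORT (plain `def`; -imc's v6 row keeps `@[conjecture]`, dropped here per REF1 §181 «type P53i′/P53o′ as supports, not conjectures» and the cell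
convention; -imc's bracket tag rewritten in parentheses above for the same reason; body = Sketch53 v6 8e68f24aa3ca2168 l.433–439 VERBATIM = the v4 body + REF1's repair clause
C′ `Irreducible W'.twoTorsionPolynomial.toPoly →`).  KILL RECORD (REF1-AUDIT §181 Part C, refuted-MISSTATED, v4 typing without C′): the junk CONSTANT carrier `g = C c`
(`carriesTwoTorsion_const_of_root`; excluded under C′ by `not_carriesTwoTorsion_C_of_irreducible`, Kernel file) made it the blanket claim T181i; Cremona `N < 4·10⁴`: 19 frame
pairs, **10 violations** (levels 5795, 6195, 7035, 9995; smallest `W = 5795b1 = [0,1,1,−5,4]`, rank 1, `w = −1`, vs `W' = 5795e3 = [1,−1,1,−30907,−2083624]`, rank 0, `w = +1`,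
`ψ_{W'}(−405/4) = 0`; `HOME/REF1-data/b181/data/kill_p53io.txt`).  REF1-AUDIT §181 R181i: with C′ **THEOREM-grade by a LITERAL Selmer isomorphism** `β_* Sel₂(E) = Sel₂(E')`
inside `H¹(ℚ, E'[2])`, local conditions matched place by place — unramified classes at good odd `ℓ`; `H¹_ur` at bad odd `ℓ` since `c_ℓ` odd ⟹ `E(ℚ_ℓ)/2 = E⁰(ℚ_ℓ)/2` with étale
halving (the odd-Tamagawa hypothesis on BOTH sides is load-bearing exactly at the primes bad for one curve only); `H¹(ℝ, E[2]) = 0` as `Δ < 0` for both (complex conjugation acts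
through `β`); at `2` ordinary off-Kilford the connected subgroup of `𝓔[2]` is intrinsic to the Galois module (one `ℚ₂`-point), at `2` supersingular `E[2]|_{I₂} = ω₂ ⊕ ω₂²` and
Fontaine's full faithfulness at `e = 1` [cite: Conrad1999, §1] matches the flat points — hence `dim Sel₂(E) = dim Sel₂(E')`, `E(ℚ)[2] = 0 = E'(ℚ)[2]`, and 2-parity
[cite: Monsky1996, Thm. 1.5] gives `w(E) = w(E')`; no Poonen–Rains refinement, no modular symbols («the E-side shadow»; modular content only through P53b); -imc add3 census
18 575/18 575 to `N < 5·10⁵`.  REF2-PLACEMENT v48 §3.2 (a3854332596164e6): **COROLLARY OF PRINT, and print gives MORE — `Sel₂(W) = β_* Sel₂(W′)` inside `H¹(ℚ, W[2])`**: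
[cite: Cesnavicius2016SelmerFlat, Thm. 1.1(a)(b), Remark (wo-ii), Example (2-ss-eg) (arXiv p0003 L14–22, p0009 L1–22)] (`H¹_fppf(ℤ, 𝓦[2]) = Sel₂ W` when `∏ c_v` is odd and `W(ℝ)` is connected;
the flat model at 2 is determined by the Galois module at supersingular 2) + [cite: PoonenRains2012, Prop. 4.12] + REF2's 5-line supplement (E1) for ORDINARY off-Kilford pairs (flat models =
extensions of `ℤ/2` by `μ₂`, `Ext¹ = H¹_fppf(ℤ₂, μ₂) = ℤ₂^×/□ ↪ ℚ₂^×/□`; `¬ TwoTorsionSplitAtTwo W` is exactly (E1)'s hypothesis) + Monsky; nothing is decoration (drop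
odd-Tamagawa on one side and Thm 1.1(b) fails); not found stated verbatim for ordinary reduction at 2; a theorem to PROVE in the tree, not a fact to file; beyond-print theorem: no.  REF2 v49 §5 CAUTION on the
«Fontaine's full faithfulness at `e = 1` [cite: Conrad1999, §1]» clause above: at `p = 2` it holds only for CONNECTED/unipotent objects — fine for supersingular pairs, where the sharper
print is [cite: Cesnavicius2016SelmerFlat, Example (2-ss-eg)] = [cite: Raynaud1974, Prop. 3.3.2 (3°)] (v49 §2.2′; and in-cell IMC-KA54 THM A `SupersingularKummerLineCanonicalAtTwo`,
`F1Sign2/SupersingularKummerAtlasAtTwo.lean`: the supersingular local condition is ONE canonical line for all curves); ordinary off-Kilford = v48 §3.2 (E1), already in this rider. -/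
def ImaginaryOddTamagawaParityLawAtTwo : Prop :=
  ∀ {N : ℕ} [NeZero N] (W W' : WeierstrassCurve ℚ) (f f' : CuspForm (Gamma0 N) 2),
    Odd N → W.IsElliptic → W'.IsElliptic → IsNewformOf W f → IsNewformOf W' f' →
    Irreducible W.twoTorsionPolynomial.toPoly → Irreducible W'.twoTorsionPolynomial.toPoly →
    W.Δ < 0 → ¬ TwoTorsionSplitAtTwo W →
    Odd W.tamagawaProduct → Odd W'.tamagawaProduct →
    (∃ g : Polynomial ℚ, CarriesTwoTorsion W W' g) → W.rootNumber = W'.rootNumber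

/-- **SUPPORT P53o′ `RealOddTamagawaOrientationLawAtTwo` — REAL ODD-TAMAGAWA ORIENTATION LAW, REPAIRED (REF1 §181 C′).**  -imc g17's text (Sketch53 v6): «P53o — REAL ODD-TAMAGAWA ORIENTATION LAW (REF1 R178b typed and extended: conjecture; census 399/399
pairs N < 10⁴ across `a₂ ∈ {0, ±1, ±2}`; REF1: 3345/3345 `a₂ = 0` pairs N < 5·10⁵; fails without the
Tamagawa hypothesis (125/206) and inside the Kilford stratum (21/42)).  Same odd conductor, isomorphic
irreducible non-cyclic `E[2]`, `Δ > 0`, all Tamagawa numbers odd, outside the Kilford stratum: the root numbers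
agree **iff** the Galois bijection keeps the order of the outer real roots (`β ∈ {id, (e₂e₃), (e₁e₂)}`),
equivalently (by P53b) iff the congruence of mod-2 symbols does not cross signs (`Φ⁺' ≢ Φ⁻` and `Φ⁻' ≢ Φ⁺`).
Why it might fail: unexplained reciprocity between the real place and the `2`-adic local condition (naive
parity lemma predicts `[β moves e₁]` only; the observed correction `[β = (e₁e₂)]` is a theta-characteristic /
Poonen–Rains term not yet derived — add3: derived, the archimedean theta form vanishes exactly on the outer roots).
v6 (P53o′): the v4/v5 typing omitted `Irreducible ψ_{W'}` and was KILLED-misstated by the constant carrier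
(REF1-AUDIT §181 T181o: 141e1 vs 141c4, 25/45); with the clause REF1 R181o grades it THEOREM-grade (never-middle).»
(-imc's tag: conjecture: REF1-AUDIT §178 R178b, §181 R181o; MEMO-imc §10.96-add2/add3.)
FILED AS A SUPPORT (plain `def`, attribute dropped as for P53i′; body = Sketch53 v6 8e68f24aa3ca2168 l.453–461 VERBATIM = the v4 body + REF1's repair clause C′).  KILL RECORD
(REF1-AUDIT §181 Part C, refuted-MISSTATED, v4 typing without C′): with the constant carrier `g = C c` the right-hand side reads `c < c`, so the v4 row forced `w(W) ≠ w(W')`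
blanket-wise (T181o); Cremona `N < 4·10⁴`: 45 frame pairs, **25 violations** (levels 141, 1293, 2717, 3165, 5757, 7077, 10005, 13485, 19565, 29541; smallest `W = 141e1 =
[0,1,1,−26,−61]`, rank 0, vs `W' = 141c4 = [1,0,0,−752,7875]`, rank 0, `ψ_{W'}(63/4) = 0`: both `w = +1` while the typed right side is `63/4 < 63/4`).  REF1-AUDIT §181 R181o:
with C′ **THEOREM-grade and -imc's observed correction `[β = (12)]` is DERIVED**: same matching at all finite places as R181i; at `∞` (three real 2-torsion points `T₁, T₂, T₃` at
`e₁ < e₂ < e₃`) R180a NEVER-MIDDLE ([cite: PoonenRains2012, Thm. 4.13]: the `∞`-relaxed group `S ⊋ S₀` has `dim S/S₀ = 1` (Greenberg–Wiles) and `I := loc_∞ S` is a `q_∞`-isotropic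
LINE, `q(T_i) = [(e_i − e_j)(e_i − e_k) < 0]`, so `I ∈ {⟨T₁⟩, ⟨T₃⟩}` for E's order AND `∈ {⟨β⁻¹T'₁⟩, ⟨β⁻¹T'₃⟩}` for E′'s; `Sel₂(E) = S` iff `I = ⟨T_least⟩ = δ(E(ℝ)/2E(ℝ))`, else
`= S₀`) gives `dim Sel₂(E) − dim Sel₂(E') = [I = ⟨T₁⟩] − [I = ⟨β⁻¹T'₁⟩] ∈ {0, ±1}` and the six cases `π ∈ S₃`: `π ∈ {id, (23), (12)}` ⟹ equal, `π ∈ {(13), (123), (132)}` ⟹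
dims differ by ONE ⟹ `w(E) ≠ w(E')` (Monsky); i.e. **`w(E) = w(E') ⟺ β(e₁) < β(e₃)`** = the typed `evalReal g x₁ < evalReal g x₃` on the nose, including the `(12)`-cell (13/13) and REF1's
π-law census §180 R180b (13 500 pairs `N < 5·10⁵`, 0 exceptions); -imc add3 17 706/17 706.  Both repaired laws hold on the Kilford stratum too PROVIDED `β` respects the connected
`ℚ₂`-point (P53f's bit).  REF2-PLACEMENT v48 §3.3: **PRINT-ASSEMBLY (≈ 12 lines)** — common relaxed group `R` ([cite: Cesnavicius2016SelmerFlat, Thm. 1.1(a)] + (E1)); `loc_∞ R` is a line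
by the Greenberg–Wiles product formula (the factor `[ℤ₂ : 2ℤ₂] = 2` is the only place 2 enters, alike for every pair); isotropic for `q_{∞,W}` and `β^* q_{∞,W′}` by
[cite: PoonenRains2012, Prop. 4.10, Thm. 4.13(a)]; `W_∞(W) = ⟨T₁⟩` ([cite: BarrerasalazarPacettiTornaria2021, Lemma 1.1(ii)]); six-case analysis ⟹ `w(W) = w(W′) ⟺ π(1) < π(3)`; the
«2-adic term [egg-swap]» of MEMO-imc §10.96-add2 is NOT 2-adic — archimedean isotropy through `R`; not in print as a statement; beyond-print theorem: no. -/
def RealOddTamagawaOrientationLawAtTwo : Prop :=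
  ∀ {N : ℕ} [NeZero N] (W W' : WeierstrassCurve ℚ) (f f' : CuspForm (Gamma0 N) 2),
    Odd N → W.IsElliptic → W'.IsElliptic → IsNewformOf W f → IsNewformOf W' f' →
    Irreducible W.twoTorsionPolynomial.toPoly → Irreducible W'.twoTorsionPolynomial.toPoly →
    ¬ IsSquare W.Δ → 0 < W.Δ → ¬ TwoTorsionSplitAtTwo W →
    Odd W.tamagawaProduct → Odd W'.tamagawaProduct →
    ∀ g : Polynomial ℚ, CarriesTwoTorsion W W' g →
    ∀ x₁ x₃ : ℝ, IsLeastTwoTorsionRoot W x₁ → IsGreatestTwoTorsionRoot W x₃ →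
      (W.rootNumber = W'.rootNumber ↔ evalReal g x₁ < evalReal g x₃)

end Summit.BirchSwinnertonDyer.Rank1Residual.F1Sign2

end
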